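import Literature.NumberTheory.DiophantineGeometry.SymmetricGroupRepsSignTwist
import Literature.NumberTheory.DiophantineGeometry.SymmetricGroupRepsCompletenessProofs
import HarnessLib

/-!
# Character sums `∑_σ χ^μ(σ) σ` of the symmetric group: Young-symmetrizer formula and
# resolution of the identity

For a partition `μ ⊢ d` and a field `k` let `χ^μ` be the character of the Specht module
`S^μ = k[S_d] c_μ` (`spechtCharacter`, file `SymmetricGroupReps`) and put

* `spechtCharacterSum k μ = s_μ := ∑_{σ ∈ S_d} χ^μ(σ) σ ∈ k[S_d]`.

Up to the factor `dim S^μ / d!` (and `χ^μ(σ⁻¹) = χ^μ(σ)`) this is the central idempotent of the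
block of `S^μ`, i.e. the element by which `k[S_d]` acts on any representation as (a multiple of)
the projection onto the `μ`-isotypic component (Fulton–Harris, §2.4, formula (2.32)). This file
proves, sorry-free and for every field of characteristic zero:

* `spechtCharacterSum_comm`: `s_μ` is central.
* `coeff_sq_mul_spechtCharacter_eq_sum` — **the character of `k[S_d] c_μ` from the quasi-idempotent**:
  `n_μ χ^μ(g) = ∑_{x ∈ S_d} c_μ(x⁻¹ g⁻¹ x)`, where `c_μ² = n_μ c_μ` (`n_μ = d!/f^μ ≠ 0`); this is the
  trace of `y ↦ g y c_μ` on `k[S_d]`, computed once through the projection `y ↦ n_μ⁻¹ y c_μ` of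
  `k[S_d]` onto `k[S_d] c_μ` and once in the basis of permutations.
* `spechtCharacterSum_eq` — consequently `s_μ = n_μ⁻¹ ∑_{x ∈ S_d} x (b_μ a_μ) x⁻¹` is the average of
  the conjugates of the flipped Young symmetrizer `ĉ_μ = b_μ a_μ` (`grpAlgFlip_youngSymmetrizer`).
* `mul_mul_spechtCharacterSum_eq_zero` — hence `P w s_μ = 0` for all `w` as soon as
  `P g b_μ = 0` for every `g ∈ S_d` (the form in which the vanishing lemmas of Fulton–Harris,
  Lemma 4.23, propagate from Young symmetrizers to isotypic projections).
* `exists_sum_smul_spechtCharacterSum_eq_one` — **resolution of the identity**: over an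
  algebraically closed field of characteristic zero, `1 ∈ k[S_d]` is a `k`-linear combination of the
  `s_μ`, `μ ⊢ d` (the Specht characters are `p(d)` orthonormal class functions, and the class
  functions of `S_d` have dimension `≤ p(d)`, so `δ_1` is in their span; Fulton–Harris,
  Prop. 2.30 / Cor. 2.13 with Thm. 4.3).

These are the group-algebra inputs for the isotypic projections `P_λ` of
Christandl–Vrana–Zuiddam's upper quantum functional
(`Literature.Computability.AlgebraicComplexity.QuantumFunctionalsUpper`): Schur–Weyl vanishing and
the branching (Littlewood–Richardson) vanishing on Young sub-alphabets.

## References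

* W. Fulton, J. Harris, *Representation Theory. A First Course*, GTM 129 (1991): §2.2
  (Thm. 2.12, Cor. 2.13), §2.4 (Prop. 2.30, (2.32)), §4.1–4.2 (Thm. 4.3, Lemma 4.26).
  [FultonHarrisGTM129]
* G. D. James, *The Representation Theory of the Symmetric Groups*, LNM 682 (1978), §§4, 6, 11.
  [JamesLNM682]

## Mathlib and tree

From Mathlib: `Representation.char_orthonormal`, `LinearMap.trace_comp_comm'`,
`LinearMap.trace_eq_matrix_trace`, `MonoidAlgebra.basis`, `Equiv.Perm.partition_eq_of_isConj`,
`Submodule.mem_span_range_iff_exists_fun`. From the tree: `youngSymmetrizer_sq`,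
`coeff_sq_youngSymmetrizer_ne_zero`, `grpAlgFlip_youngSymmetrizer`, `spechtCharacter_conj`,
`isIrreducible_spechtRep_holds`, `nonempty_equiv_iff_holds`, `linearIndependent_of_orthonormal`.
-/

noncomputable section

open scoped BigOperators

namespace Literature.NumberTheory.DiophantineGeometry

section CplxAlg

variable (k : Type*) [Field k] {d : ℕ}

/-! ### The character sum `s_μ` -/

/-- The **character sum** `s_μ = ∑_{σ ∈ S_d} χ^μ(σ) σ ∈ k[S_d]` of the Specht character `χ^μ`
(Fulton–Harris §2.4, (2.32): `(dim W/|G|) ∑_g \overline{χ_W(g)} g` is the projection onto the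
`W`-isotypic component; for `S_d` the characters are real and `χ(g⁻¹) = χ(g)`).
[cite: FultonHarrisGTM129, §2.4 (2.32)] -/
def spechtCharacterSum (μ : Nat.Partition d) : MonoidAlgebra k (Equiv.Perm (Fin d)) :=
  ∑ σ : Equiv.Perm (Fin d), spechtCharacter k μ σ • MonoidAlgebra.of k _ σ

/-- Unfolding of `spechtCharacterSum`. [folklore] -/
theorem spechtCharacterSum_def (μ : Nat.Partition d) :
    spechtCharacterSum k μ =
      ∑ σ : Equiv.Perm (Fin d), spechtCharacter k μ σ • MonoidAlgebra.of k _ σ :=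
  rfl

/-- Coefficients of a combination of group elements: `(∑_σ f(σ) σ)(g) = f(g)`. [folklore] -/
theorem coeff_sum_smul_of {G : Type*} [Group G] [Fintype G] (f : G → k) (g : G) :
    (∑ σ : G, f σ • MonoidAlgebra.of k G σ).coeff g = f g := by
  classical
  rw [MonoidAlgebra.coeff_sum, Finsupp.finsetSum_apply]
  simp_rw [MonoidAlgebra.coeff_smul, Finsupp.smul_apply, MonoidAlgebra.of_apply,
    MonoidAlgebra.coeff_single, Finsupp.single_apply, smul_eq_mul, mul_ite, mul_one, mul_zero]
  rw [Finset.sum_ite_eq']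
  simp

/-- Every element of the group algebra of a finite group is the combination `∑_g x(g) g` of group
elements. [folklore] -/
theorem eq_sum_coeff_smul_of {G : Type*} [Group G] [Fintype G] (x : MonoidAlgebra k G) :
    x = ∑ g : G, x.coeff g • MonoidAlgebra.of k G g := by
  apply MonoidAlgebra.ext
  ext g
  rw [coeff_sum_smul_of]

/-- The coefficients of `s_μ` are the character values: `s_μ(σ) = χ^μ(σ)`. [folklore] -/
theorem coeff_spechtCharacterSum (μ : Nat.Partition d) (σ : Equiv.Perm (Fin d)) :
    (spechtCharacterSum k μ).coeff σ = spechtCharacter k μ σ :=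
  coeff_sum_smul_of k _ σ

/-- `s_μ` is invariant under conjugation: `g s_μ g⁻¹ = s_μ` (the character is a class function,
Fulton–Harris, Prop. 2.1). [folklore] -/
theorem of_mul_spechtCharacterSum_mul_of_inv (μ : Nat.Partition d) (g : Equiv.Perm (Fin d)) :
    MonoidAlgebra.of k _ g * spechtCharacterSum k μ * MonoidAlgebra.of k _ g⁻¹ =
      spechtCharacterSum k μ := by
  rw [spechtCharacterSum, Finset.mul_sum, Finset.sum_mul]
  refine Fintype.sum_equiv (MulAut.conj g).toEquiv _ _ fun σ => ?_
  simp only [MulEquiv.toEquiv_eq_coe, MulEquiv.coe_toEquiv, MulAut.conj_apply]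
  rw [spechtCharacter_conj, mul_smul_comm, smul_mul_assoc, ← map_mul, ← map_mul]

/-- **`s_μ` is central** in `k[S_d]`: `x s_μ = s_μ x` for every `x` (Fulton–Harris, Prop. 2.28 ⇒
§2.4: combinations of class sums are central). [folklore] -/
theorem spechtCharacterSum_comm (μ : Nat.Partition d) (x : MonoidAlgebra k (Equiv.Perm (Fin d))) :
    x * spechtCharacterSum k μ = spechtCharacterSum k μ * x := by
  induction x using MonoidAlgebra.induction_on with
  | hM g =>
    conv_lhs => rw [← of_mul_spechtCharacterSum_mul_of_inv k μ g⁻¹]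
    rw [inv_inv, ← mul_assoc, ← mul_assoc, ← map_mul, mul_inv_cancel, map_one, one_mul]
  | hadd x y hx hy => rw [add_mul, mul_add, hx, hy]
  | hsmul r x hx => rw [smul_mul_assoc, mul_smul_comm, hx]

/-! ### The character of `k[S_d] c_μ` through the quasi-idempotent `c_μ` -/

/-- **Character of the Specht module from the Young symmetrizer**: with `c_μ² = n_μ c_μ`
(`youngSymmetrizer_sq`), `n_μ χ^μ(g) = ∑_{x ∈ S_d} c_μ(x⁻¹ g⁻¹ x)` for every `g ∈ S_d`. Both sides
are the trace of `y ↦ g · y · c_μ` on `k[S_d]`: this map is `g ∘ (n_μ p)` for the projection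
`p : y ↦ n_μ⁻¹ y c_μ` of `k[S_d]` onto `S^μ = k[S_d] c_μ`, so its trace is `n_μ` times the trace of
`g` on `S^μ`; in the basis of permutations its diagonal entry at `x` is the coefficient of `x` in
`g x c_μ`, i.e. `c_μ(x⁻¹ g⁻¹ x)`. (The classical formula for the character afforded by a
quasi-idempotent; James, LNM 682, §11; Fulton–Harris, §4.2, proof of Lemma 4.26.) [folklore] -/
theorem coeff_sq_mul_spechtCharacter_eq_sum [CharZero k] (μ : Nat.Partition d)
    (g : Equiv.Perm (Fin d)) :
    (youngSymmetrizer k μ * youngSymmetrizer k μ).coeff 1 * spechtCharacter k μ g =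
      ∑ x : Equiv.Perm (Fin d), (youngSymmetrizer k μ).coeff (x⁻¹ * g⁻¹ * x) := by
  classical
  set c := youngSymmetrizer k μ with hc
  set n : k := (c * c).coeff 1 with hn
  set V := spechtIdeal k μ with hV
  -- the projection `y ↦ y c` of `k[S_d]` into `V` and the inclusion of `V`
  let proj : MonoidAlgebra k (Equiv.Perm (Fin d)) →ₗ[k] V :=
    { toFun := fun y => ⟨y * c, Ideal.mul_mem_left _ y (youngSymmetrizer_mem_spechtIdeal k μ)⟩
      map_add' := fun y z => by
        apply Subtype.ext
        simp [add_mul]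
      map_smul' := fun r y => by
        apply Subtype.ext
        simp }
  let incl : V →ₗ[k] MonoidAlgebra k (Equiv.Perm (Fin d)) := V.subtype.restrictScalars k
  have hproj : ∀ y, (proj y : MonoidAlgebra k (Equiv.Perm (Fin d))) = y * c := fun y => rfl
  have hincl : ∀ v : V, incl v = (v : MonoidAlgebra k (Equiv.Perm (Fin d))) := fun v => rfl
  -- `p ∘ i = n • id` on `V`: `v c = n v` for `v ∈ k[S_d] c`
  have h1 : proj ∘ₗ incl = n • LinearMap.id := by
    apply LinearMap.ext
    intro v
    apply Subtype.ext
    rw [LinearMap.comp_apply, hproj, hincl, LinearMap.smul_apply, LinearMap.id_apply,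
      Submodule.coe_smul_of_tower]
    obtain ⟨y, hy⟩ := Ideal.mem_span_singleton'.mp v.2
    rw [← hy, mul_assoc]
    conv_lhs => rw [youngSymmetrizer_sq k μ]
    rw [← hn, mul_smul_comm]
  -- `ρ(g) ∘ p = p ∘ (g ·)`
  have h2 : spechtRep k μ g ∘ₗ proj =
      proj ∘ₗ LinearMap.mulLeft k (MonoidAlgebra.of k (Equiv.Perm (Fin d)) g) := by
    apply LinearMap.ext
    intro y
    apply Subtype.ext
    rw [LinearMap.comp_apply, LinearMap.comp_apply, spechtRep_apply, hproj, hproj,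
      LinearMap.mulLeft_apply, mul_assoc]
  -- `i ∘ p = (· c)`
  have h3 : incl ∘ₗ proj = LinearMap.mulRight k c := by
    apply LinearMap.ext
    intro y
    rw [LinearMap.comp_apply, hincl, hproj, LinearMap.mulRight_apply]
  -- the trace of `ρ(g)` on `V`, times `n`, is the trace of `y ↦ g y c` on `k[S_d]`
  have key : n * spechtCharacter k μ g =
      LinearMap.trace k _ (LinearMap.mulRight k c ∘ₗ
        LinearMap.mulLeft k (MonoidAlgebra.of k (Equiv.Perm (Fin d)) g)) := by
    calc n * spechtCharacter k μ g
        = LinearMap.trace k V (spechtRep k μ g ∘ₗ (n • LinearMap.id)) := by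
          rw [spechtCharacter_apply, LinearMap.comp_smul, LinearMap.comp_id, map_smul,
            smul_eq_mul]
      _ = LinearMap.trace k V ((spechtRep k μ g ∘ₗ proj) ∘ₗ incl) := by
          rw [← h1, LinearMap.comp_assoc]
      _ = LinearMap.trace k _ (incl ∘ₗ (spechtRep k μ g ∘ₗ proj)) :=
          LinearMap.trace_comp_comm' _ _
      _ = _ := by rw [h2, ← LinearMap.comp_assoc, h3]
  rw [key, LinearMap.trace_eq_matrix_trace k (MonoidAlgebra.basis (Equiv.Perm (Fin d)) k),
    Matrix.trace]
  refine Finset.sum_congr rfl fun x _ => ?_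
  rw [Matrix.diag_apply, LinearMap.toMatrix_apply, MonoidAlgebra.basis_apply,
    LinearMap.comp_apply, LinearMap.mulLeft_apply, LinearMap.mulRight_apply]
  change (MonoidAlgebra.of k (Equiv.Perm (Fin d)) g * MonoidAlgebra.single x 1 * c).coeff x = _
  rw [MonoidAlgebra.of_apply, MonoidAlgebra.single_mul_single, one_mul,
    MonoidAlgebra.coeff_single_mul_apply, one_mul, mul_inv_rev]

/-- The flipped Young symmetrizer as a combination of group elements:
`b_μ a_μ = ĉ_μ = ∑_w c_μ(w) w⁻¹`. [folklore] -/
theorem colAntisymmetrizer_mul_rowSymmetrizer_eq_sum (μ : Nat.Partition d) :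
    colAntisymmetrizer k μ * rowSymmetrizer k μ =
      ∑ w : Equiv.Perm (Fin d), (youngSymmetrizer k μ).coeff w • MonoidAlgebra.of k _ w⁻¹ := by
  rw [← grpAlgFlip_youngSymmetrizer]
  conv_lhs => rw [eq_sum_coeff_smul_of k (youngSymmetrizer k μ)]
  rw [map_sum]
  refine Finset.sum_congr rfl fun w _ => ?_
  rw [map_smul, MonoidAlgebra.of_apply, MonoidAlgebra.of_apply, grpAlgFlip_single]

/-- A conjugate of the flipped Young symmetrizer as a combination of group elements:
`x (b_μ a_μ) x⁻¹ = ∑_σ c_μ(x⁻¹ σ⁻¹ x) σ`. [folklore] -/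
theorem of_mul_col_mul_row_mul_of_inv (μ : Nat.Partition d) (x : Equiv.Perm (Fin d)) :
    MonoidAlgebra.of k _ x * (colAntisymmetrizer k μ * rowSymmetrizer k μ) *
        MonoidAlgebra.of k _ x⁻¹ =
      ∑ σ : Equiv.Perm (Fin d),
        (youngSymmetrizer k μ).coeff (x⁻¹ * σ⁻¹ * x) • MonoidAlgebra.of k _ σ := by
  rw [colAntisymmetrizer_mul_rowSymmetrizer_eq_sum, Finset.mul_sum, Finset.sum_mul]
  -- reindex `σ = x w⁻¹ x⁻¹`, i.e. `w = x⁻¹ σ⁻¹ x`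
  symm
  refine Fintype.sum_equiv ((MulAut.conj x⁻¹).toEquiv.trans (Equiv.inv _)) _ _ fun σ => ?_
  simp only [Equiv.trans_apply, MulEquiv.toEquiv_eq_coe, MulEquiv.coe_toEquiv,
    MulAut.conj_apply, inv_inv, Equiv.inv_apply, mul_inv_rev]
  rw [mul_smul_comm, smul_mul_assoc, ← map_mul, ← map_mul]
  congr 2
  group

/-- **The character sum through the Young symmetrizer**:
`s_μ = ∑_σ χ^μ(σ) σ = n_μ⁻¹ ∑_{x ∈ S_d} x (b_μ a_μ) x⁻¹`, the average of the conjugates of the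
flipped Young symmetrizer `ĉ_μ = b_μ a_μ` (from `coeff_sq_mul_spechtCharacter_eq_sum`, summing
over `g`). [folklore] -/
theorem spechtCharacterSum_eq [CharZero k] (μ : Nat.Partition d) :
    spechtCharacterSum k μ = ((youngSymmetrizer k μ * youngSymmetrizer k μ).coeff 1)⁻¹ •
      ∑ x : Equiv.Perm (Fin d), MonoidAlgebra.of k _ x *
        (colAntisymmetrizer k μ * rowSymmetrizer k μ) * MonoidAlgebra.of k _ x⁻¹ := by
  set n : k := (youngSymmetrizer k μ * youngSymmetrizer k μ).coeff 1 with hn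
  have hn0 : n ≠ 0 := coeff_sq_youngSymmetrizer_ne_zero k μ
  have hχ : ∀ σ : Equiv.Perm (Fin d), spechtCharacter k μ σ =
      n⁻¹ * ∑ x : Equiv.Perm (Fin d), (youngSymmetrizer k μ).coeff (x⁻¹ * σ⁻¹ * x) := by
    intro σ
    rw [← coeff_sq_mul_spechtCharacter_eq_sum, ← hn, ← mul_assoc, inv_mul_cancel₀ hn0, one_mul]
  simp_rw [of_mul_col_mul_row_mul_of_inv, spechtCharacterSum, hχ, Finset.mul_sum, Finset.sum_smul,
    Finset.smul_sum, mul_smul]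
  exact Finset.sum_comm

/-! ### Vanishing propagates from `b_μ` to `s_μ` -/

/-- If `P g b_μ = 0` for every `g ∈ S_d` then `P z b_μ = 0` for every `z ∈ k[S_d]` (linearity).
[folklore] -/
theorem mul_mul_colAntisymmetrizer_eq_zero_of_forall {μ : Nat.Partition d}
    {P : MonoidAlgebra k (Equiv.Perm (Fin d))}
    (hP : ∀ g : Equiv.Perm (Fin d), P * MonoidAlgebra.of k _ g * colAntisymmetrizer k μ = 0)
    (z : MonoidAlgebra k (Equiv.Perm (Fin d))) : P * z * colAntisymmetrizer k μ = 0 := by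
  induction z using MonoidAlgebra.induction_on with
  | hM g => exact hP g
  | hadd p q hp hq => rw [mul_add, add_mul, hp, hq, add_zero]
  | hsmul r p hp => rw [mul_smul_comm, smul_mul_assoc, hp, smul_zero]

/-- **Vanishing propagates to the character sum**: if `P g b_μ = 0` for every `g ∈ S_d`, then
`P w s_μ = 0` for every `w ∈ k[S_d]`, because `s_μ = n_μ⁻¹ ∑_x x b_μ a_μ x⁻¹`
(`spechtCharacterSum_eq`). This is how Fulton–Harris, Lemma 4.23 (1) (`a_λ x b_μ = 0` unless
`λ ⊴ μ`) reaches the isotypic projections. [folklore] -/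
theorem mul_mul_spechtCharacterSum_eq_zero [CharZero k] {μ : Nat.Partition d}
    {P : MonoidAlgebra k (Equiv.Perm (Fin d))}
    (hP : ∀ g : Equiv.Perm (Fin d), P * MonoidAlgebra.of k _ g * colAntisymmetrizer k μ = 0)
    (w : MonoidAlgebra k (Equiv.Perm (Fin d))) : P * w * spechtCharacterSum k μ = 0 := by
  rw [spechtCharacterSum_eq, mul_smul_comm, Finset.mul_sum]
  refine smul_eq_zero_of_right _ (Finset.sum_eq_zero fun x _ => ?_)
  have h := mul_mul_colAntisymmetrizer_eq_zero_of_forall k hP (w * MonoidAlgebra.of k _ x)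
  calc P * w * (MonoidAlgebra.of k _ x * (colAntisymmetrizer k μ * rowSymmetrizer k μ) *
        MonoidAlgebra.of k _ x⁻¹)
      = P * (w * MonoidAlgebra.of k _ x) * colAntisymmetrizer k μ *
          (rowSymmetrizer k μ * MonoidAlgebra.of k _ x⁻¹) := by simp only [mul_assoc]
    _ = 0 := by rw [h, zero_mul]

/-- Symmetric form: if `P g b_μ = 0` for every `g`, then also `s_μ w P' = 0`-type products vanish
when written as `P w s_μ`; recorded here is the special case `P s_μ = 0`. [folklore] -/
theorem mul_spechtCharacterSum_eq_zero [CharZero k] {μ : Nat.Partition d}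
    {P : MonoidAlgebra k (Equiv.Perm (Fin d))}
    (hP : ∀ g : Equiv.Perm (Fin d), P * MonoidAlgebra.of k _ g * colAntisymmetrizer k μ = 0) :
    P * spechtCharacterSum k μ = 0 := by
  simpa using mul_mul_spechtCharacterSum_eq_zero k hP 1

/-! ### Resolution of the identity: `1 ∈ span_k {s_μ : μ ⊢ d}` -/

/-- The Specht characters `χ^μ`, `μ ⊢ d`, are linearly independent functions on `S_d` over an
algebraically closed field of characteristic zero: they are orthonormal (Fulton–Harris, Thm. 2.12,
Mathlib's `Representation.char_orthonormal`, the `S^μ` being irreducible and pairwise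
non-isomorphic, Thm. 4.3). [cite: FultonHarrisGTM129, Theorem 2.12 with Theorem 4.3] -/
theorem linearIndependent_spechtCharacter [IsAlgClosed k] [CharZero k] :
    LinearIndependent k (fun μ : Nat.Partition d => spechtCharacter k μ) := by
  classical
  have hcard_ne : (Nat.card (Equiv.Perm (Fin d)) : k) ≠ 0 := Nat.cast_ne_zero.2 Nat.card_pos.ne'
  letI : Invertible (Nat.card (Equiv.Perm (Fin d)) : k) := invertibleOfNonzero hcard_ne
  refine linearIndependent_of_orthonormal k _ fun lam μ => ?_
  haveI : (spechtRep k lam).IsIrreducible := isIrreducible_spechtRep_holds lam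
  haveI : (spechtRep k μ).IsIrreducible := isIrreducible_spechtRep_holds μ
  have h := Representation.char_orthonormal (spechtRep k lam) (spechtRep k μ)
  rw [spechtCharacter_eq_character, spechtCharacter_eq_character, h]
  by_cases hlm : lam = μ
  · subst hlm
    rw [if_pos ⟨Representation.Equiv.refl _⟩, if_pos rfl]
  · have hne : ¬Nonempty ((spechtRep k μ).Equiv (spechtRep k lam)) :=
      fun hne => hlm ((nonempty_equiv_iff_holds (k := k)).1 hne).symm
    rw [if_neg hne, if_neg hlm]

/-- **Resolution of the identity in `k[S_d]`**: over an algebraically closed field of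
characteristic zero there are scalars `e_μ` (`= f^μ/d!`, not needed here) with
`∑_{μ ⊢ d} e_μ s_μ = 1`. Proof: the `p(d)` Specht characters are linearly independent class
functions (`linearIndependent_spechtCharacter`), class functions factor through the cycle type
(`Equiv.Perm.partition`) and so form a space of dimension `≤ p(d)`; hence the `χ^μ` span all class
functions, in particular `δ_1 = ∑ e_μ χ^μ`, and `∑ e_μ s_μ = ∑_g δ_1(g) g = 1` (Fulton–Harris,
Prop. 2.30 and Cor. 2.13, §2.4). [cite: FultonHarrisGTM129, Proposition 2.30 and §2.4] -/
theorem exists_sum_smul_spechtCharacterSum_eq_one [IsAlgClosed k] [CharZero k] :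
    ∃ e : Nat.Partition d → k, ∑ μ : Nat.Partition d, e μ • spechtCharacterSum k μ = 1 := by
  classical
  set χ : Nat.Partition d → Equiv.Perm (Fin d) → k := fun μ => spechtCharacter k μ with hχ
  have hli : LinearIndependent k χ := linearIndependent_spechtCharacter k
  -- class functions: the range of `P`
  let P : ((Fintype.card (Fin d)).Partition → k) →ₗ[k] (Equiv.Perm (Fin d) → k) :=
    LinearMap.funLeft k k Equiv.Perm.partition
  have hmem : ∀ μ, χ μ ∈ LinearMap.range P := by
    intro μ
    refine ⟨fun p => if h : ∃ g : Equiv.Perm (Fin d), g.partition = p then χ μ h.choose else 0, ?_⟩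
    ext g
    have h : ∃ g' : Equiv.Perm (Fin d), g'.partition = g.partition := ⟨g, rfl⟩
    simp only [P, LinearMap.funLeft_apply]
    rw [dif_pos h]
    obtain ⟨c, hc⟩ := isConj_iff.1 (Equiv.Perm.partition_eq_of_isConj.2 h.choose_spec)
    have key := (spechtRep k μ).char_conj h.choose c
    rw [hc] at key
    exact key.symm
  have hle : Submodule.span k (Set.range χ) ≤ LinearMap.range P :=
    Submodule.span_le.2 (Set.range_subset_iff.2 hmem)
  have hfin : Module.finrank k (LinearMap.range P) ≤
      Module.finrank k (Submodule.span k (Set.range χ)) := by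
    rw [finrank_span_eq_card hli]
    calc Module.finrank k (LinearMap.range P)
        ≤ Module.finrank k ((Fintype.card (Fin d)).Partition → k) := LinearMap.finrank_range_le P
      _ = Fintype.card ((Fintype.card (Fin d)).Partition) := Module.finrank_fintype_fun_eq_card k
      _ = Fintype.card (Nat.Partition d) := by rw [Fintype.card_fin]
  have hspan : Submodule.span k (Set.range χ) = LinearMap.range P :=
    Submodule.eq_of_le_of_finrank_le hle hfin
  -- `δ_1` is a class function
  set δ : Equiv.Perm (Fin d) → k := fun g => if g = 1 then 1 else 0 with hδ
  have hδmem : δ ∈ LinearMap.range P := by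
    refine ⟨fun p => if p = (1 : Equiv.Perm (Fin d)).partition then 1 else 0, ?_⟩
    ext g
    simp only [P, LinearMap.funLeft_apply, hδ]
    by_cases hg : g = 1
    · rw [if_pos (by rw [hg]), if_pos hg]
    · rw [if_neg, if_neg hg]
      intro h
      exact hg (isConj_one_left.1 (Equiv.Perm.partition_eq_of_isConj.2 h))
  rw [← hspan, Submodule.mem_span_range_iff_exists_fun] at hδmem
  obtain ⟨e, he⟩ := hδmem
  refine ⟨e, ?_⟩
  calc ∑ μ, e μ • spechtCharacterSum k μ
      = ∑ g : Equiv.Perm (Fin d), (∑ μ, e μ • χ μ) g • MonoidAlgebra.of k _ g := by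
        simp only [spechtCharacterSum, Finset.smul_sum, smul_smul]
        rw [Finset.sum_comm]
        refine Finset.sum_congr rfl fun g _ => ?_
        rw [Finset.sum_apply, Finset.sum_smul]
        refine Finset.sum_congr rfl fun μ _ => ?_
        rw [Pi.smul_apply, smul_eq_mul]
    _ = ∑ g : Equiv.Perm (Fin d), δ g • MonoidAlgebra.of k _ g := by rw [he]
    _ = 1 := by
        simp only [hδ, ite_smul, one_smul, zero_smul, Finset.sum_ite_eq', Finset.mem_univ,
          if_true, map_one]

end CplxAlg

end Literature.NumberTheory.DiophantineGeometry

end
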